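import Mathlib
import Summits.MatrixMultiplication.MatrixMultiplication.Theorems.SnSubsetDichotomyHyperoctahedralThresholdTwinSupply
import Summits.MatrixMultiplication.MatrixMultiplication.Theorems.SnSubsetDichotomyHyperoctahedralThresholdRotationIdentity

/-!
# The involutive-symmetry regime of the open core `stub_poorRigidCore`
(crux `SnSubsetDichotomy.HyperoctahedralThreshold`, stmt-MatrixMultiplication-10883, live line
`Cruxes/HyperoctahedralThreshold/Lines/refutation_local_symmetry.lean`; siege k27, variation "direct pigeonhole")

Vocabulary of the line: `μ 0, μ 1, μ 2` are involutions of `Fin n`; a colour word `w : List (Fin 3)` acts on the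
right, `x · w := w.foldl (fun v c => μ c v) x`; the trajectory of `x` along `w` is `i ↦ x · w.take i`.

**The regime.**  `θ : Fin n → Fin n` is an *involutive near-symmetry*: off an exceptional set it is a fixed-point-free
involution commuting with the three colours (`θ (θ x) = x`, `θ x ≠ x`, `θ (μ c x) = μ c (θ x)`).  Exact examples:
every Cayley host (left translation by an involution), every `2`-lift, every host with a colour-preserving
fixed-point-free involutive automorphism — poor AND rigid in general (pattern classes of size `2`), so neither
`stub_richDescent` nor `stub_patternTwin` sees them.  With defects it is the involutive case of the near-automorphism
traps of crux NOTES §10 (T3) / §9E, closed here with NO expander input and NO poorness, for every forbidden set `R`.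

**`involutive_core`** (explicit form, on a colour-closed island `U`; `U = univ` globally): if every `x ∈ U ∖ B`
satisfies the three identities and `x ∉ R`, `θ x ∉ R`, and `|U|² + 3·2^r·(r+2)·|B| < 3·2^r·|U|`, the conclusion of
`stub_poorRigidCore` holds with `2 ≤ k + 1 ≤ 2 (r + 1)` rungs.  Proof — direct pigeonhole on reduced words at ONE
vertex: of the `3·2^r·|U|` reduced words of length `r + 1` based in `U` (`TwinSupply.exists_reducedWords`) at most
`3·2^r·(r+2)·|B|` meet `B` (for a fixed word and time the trajectory point is an injective function of the start),
so some `x ∈ U` starts `> |U|` `B`-free walks (all inside `U`), two of which end at the same point;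
`closed_of_collision` (strip common suffix and prefix, close up) gives a non-empty cyclically reduced `z` closing at a
point `y` with its trajectory inside the two walks; the rung walk `t ↦ (y · z.take t, θ (y · z.take t))` is clean
FOR FREE — rungs are `θ`-orbits (equal or disjoint), steps are parallel (`θμ = μθ`), points avoid `R`.
**`stub_involutiveSymmetry`** is the same in the quantifier shape of the core (`∃ n₀ ∀ n ≥ n₀ …`, `|R|, |E| ≤ n^{3/4}`,
conclusion verbatim incl. `k + 1 ≤ n^{1/4}`), at `r = ⌊log₂ n⌋ + 1`, `n₀ = 2^40`.  No definitions are introduced.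
-/

-- justification: the sub-namespace `…HyperoctahedralThreshold.InvolutiveSymmetry` repeats a path component (siblings' layout)
set_option linter.dupNamespace false

namespace Summit.MatrixMultiplication.MatrixMultiplication.Theorems.HyperoctahedralThreshold.InvolutiveSymmetry

open Finset GoodTwin

variable {n : ℕ}

/-! ### Word action -/

/-- Walking back `j` steps along the reversed word lands on an earlier trajectory point. [folklore] -/
theorem foldl_reverse_take (μ : Fin 3 → Equiv.Perm (Fin n)) (hμ : ∀ c, μ c * μ c = 1) (w : List (Fin 3))
    (x : Fin n) (j : ℕ) : (w.reverse.take j).foldl (fun v c => μ c v) (w.foldl (fun v c => μ c v) x) =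
      (w.take (w.length - j)).foldl (fun v c => μ c v) x := by
  have hw : w.foldl (fun v c => μ c v) x = (w.drop (w.length - j)).foldl (fun v c => μ c v)
      ((w.take (w.length - j)).foldl (fun v c => μ c v) x) := by
    rw [← List.foldl_append, List.take_append_drop]
  rw [List.take_reverse, hw]
  exact Rotation.foldl_act_reverse μ hμ _ _

-- adapted from Summits/.../SnSubsetDichotomyHyperoctahedralThresholdTwinSupply.lean (`cyclic_of_collision`),
-- specialised to equal lengths and one base point, and carrying a predicate `P` along the trajectory
/-- **Collision ⇒ closed walk, trajectory tracked.**  Two DISTINCT reduced words of the same length acting identically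
on `x`, all of whose trajectory points from `x` satisfy `P`, yield a point `y` and a non-empty CYCLICALLY reduced word
`z` closing at `y`, `|z| ≤ |t| + |t'|`, all of whose trajectory points from `y` satisfy `P`: strip the common suffix
(letters act injectively), strip the common prefix (moving the base point), and when both ends differ close up
`z := t ++ t'.reverse` at `y := x`. [folklore] -/
theorem closed_of_collision (μ : Fin 3 → Equiv.Perm (Fin n)) (hμ : ∀ c, μ c * μ c = 1) (P : Fin n → Prop) :
    ∀ (N : ℕ) (t t' : List (Fin 3)) (x : Fin n), t.length ≤ N → t.length = t'.length → t ≠ t' →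
      List.IsChain (· ≠ ·) t → List.IsChain (· ≠ ·) t' →
      t.foldl (fun v c => μ c v) x = t'.foldl (fun v c => μ c v) x →
      (∀ i, P ((t.take i).foldl (fun v c => μ c v) x)) → (∀ i, P ((t'.take i).foldl (fun v c => μ c v) x)) →
      ∃ (y : Fin n) (z : List (Fin 3)), z ≠ [] ∧ List.IsChain (· ≠ ·) (z ++ z) ∧
        z.length ≤ t.length + t'.length ∧ z.foldl (fun v c => μ c v) y = y ∧
        ∀ i, P ((z.take i).foldl (fun v c => μ c v) y) := by
  intro N
  induction N with
  | zero =>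
    intro t t' x hN hlen htt
    exact absurd ((List.eq_nil_of_length_eq_zero (by omega)).trans
      (List.eq_nil_of_length_eq_zero (by omega) : t' = []).symm) htt
  | succ N ih =>
    intro t t' x hN hlen htt hc hc' hx hP hP'
    have ht0 : t ≠ [] := fun h => htt (h.trans (List.eq_nil_of_length_eq_zero (by rw [← hlen, h]; rfl)).symm)
    have ht0' : t' ≠ [] := fun h => ht0 (List.eq_nil_of_length_eq_zero (by rw [hlen, h]; rfl))
    -- compare last letters
    obtain ⟨t₂, e, rfl⟩ : ∃ t₂ e, t = t₂ ++ [e] := ⟨_, _, (List.dropLast_append_getLast ht0).symm⟩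
    obtain ⟨t₂', e', rfl⟩ : ∃ t₂' e', t' = t₂' ++ [e'] := ⟨_, _, (List.dropLast_append_getLast ht0').symm⟩
    -- trajectory points of a prefix word are trajectory points of the word
    have prefP : ∀ (s l : List (Fin 3)), (∀ i, P (((s ++ l).take i).foldl (fun v c => μ c v) x)) →
        ∀ i, P ((s.take i).foldl (fun v c => μ c v) x) := by
      intro s l h i
      rcases Nat.lt_or_ge s.length i with hi | hi
      · have := h s.length
        rw [List.take_left] at this
        rwa [List.take_of_length_le hi.le]
      · simpa only [List.take_append_of_le_length hi] using h i
    by_cases hee : e = e'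
    · subst hee
      have strip : t₂.foldl (fun v c => μ c v) x = t₂'.foldl (fun v c => μ c v) x := by
        rw [List.foldl_concat, List.foldl_concat] at hx
        exact (μ e).injective hx
      have hne : t₂ ≠ t₂' := fun h => htt (by rw [h])
      simp only [List.length_append, List.length_singleton] at hN hlen
      obtain ⟨y, z, h1, h2, h3, h4, h5⟩ := ih t₂ t₂' x (by omega) (by omega) hne hc.left_of_append
        hc'.left_of_append strip (prefP _ _ hP) (prefP _ _ hP')
      exact ⟨y, z, h1, h2, by simp only [List.length_append, List.length_singleton]; omega, h4, h5⟩
    -- last letters differ: compare first letters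
    obtain ⟨d, t₁, htd⟩ := List.exists_cons_of_ne_nil ht0
    obtain ⟨d', t₁', htd'⟩ := List.exists_cons_of_ne_nil ht0'
    by_cases hdd : d = d'
    · subst hdd
      rw [htd] at hx hlen hc hN htt hP
      rw [htd'] at hx hlen hc' htt hP'
      rw [List.foldl_cons, List.foldl_cons] at hx
      have hne : t₁ ≠ t₁' := fun h => htt (by rw [h])
      simp only [List.length_cons] at hN hlen
      have consP : ∀ l : List (Fin 3), (∀ i, P (((d :: l).take i).foldl (fun v c => μ c v) x)) →
          ∀ i, P ((l.take i).foldl (fun v c => μ c v) (μ d x)) := fun l h i => by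
        simpa only [List.take_succ_cons, List.foldl_cons] using h (i + 1)
      obtain ⟨y, z, h1, h2, h3, h4, h5⟩ := ih t₁ t₁' (μ d x) (by omega) (by omega) hne
        (List.isChain_cons.1 hc).2 (List.isChain_cons.1 hc').2 hx (consP _ hP) (consP _ hP')
      exact ⟨y, z, h1, h2, by rw [htd, htd']; simp only [List.length_cons]; omega, h4, h5⟩
    -- both ends differ: close up `z := t ++ t'.reverse` at `x`
    refine ⟨x, (t₂ ++ [e]) ++ (t₂' ++ [e']).reverse, by simp, ?_,
      by simp only [List.length_append, List.length_reverse]; omega, ?_, ?_⟩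
    · have hcr : List.IsChain (· ≠ ·) (t₂' ++ [e']).reverse :=
        List.isChain_reverse.2 (hc'.imp fun a b h => fun h' => h h'.symm)
      have hz : List.IsChain (· ≠ ·) ((t₂ ++ [e]) ++ (t₂' ++ [e']).reverse) := by
        refine List.isChain_append.2 ⟨hc, hcr, fun a ha b hb => ?_⟩
        rw [List.getLast?_concat] at ha
        rw [List.head?_reverse, List.getLast?_concat] at hb
        simp only [Option.mem_def, Option.some.injEq] at ha hb
        subst ha; subst hb
        exact hee
      refine List.isChain_append.2 ⟨hz, hz, fun a ha b hb => ?_⟩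
      rw [List.getLast?_append_of_ne_nil _ (by simp), List.getLast?_reverse, htd', List.head?_cons] at ha
      rw [List.head?_append, htd, List.head?_cons, Option.some_or] at hb
      simp only [Option.mem_def, Option.some.injEq] at ha hb
      subst ha; subst hb
      exact fun h => hdd h.symm
    · rw [List.foldl_append, hx]
      exact Rotation.foldl_act_reverse μ hμ _ x
    · intro i
      rw [List.take_append, List.foldl_append]
      rcases Nat.lt_or_ge (t₂ ++ [e]).length i with hi | hi
      · rw [List.take_of_length_le hi.le, hx, foldl_reverse_take μ hμ]
        exact hP' _
      · rw [(by omega : i - (t₂ ++ [e]).length = 0), List.take_zero, List.foldl_nil]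
        exact hP i

/-! ### The regime theorem -/

/-- A colour-closed vertex set is closed under the action of every word. -/
theorem foldl_mem (μ : Fin 3 → Equiv.Perm (Fin n)) (U : Finset (Fin n)) (hU : ∀ c, ∀ x ∈ U, μ c x ∈ U) :
    ∀ (w : List (Fin 3)), ∀ x ∈ U, w.foldl (fun v c => μ c v) x ∈ U := by
  intro w
  induction w with
  | nil => exact fun x hx => hx
  | cons c w ih => exact fun x hx => ih _ (hU c x hx)

/-- **The involutive-symmetry regime of the core, explicit form** (on a colour-closed "island" `U`; `U = univ` is the
global case).  Let `μ c` be involutions of `Fin n`, `U` a vertex set closed under every `μ c`, `θ` a map and `R, B`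
sets such that every `x ∈ U ∖ B` satisfies `θ (θ x) = x`, `θ x ≠ x`, `θ (μ c x) = μ c (θ x)` for all `c`, `x ∉ R`
and `θ x ∉ R`.  If `|U|² + 3·2^r·(r+2)·|B| < 3·2^r·|U|` then there is a clean closed colour-walk of the rung graph
avoiding `R`, in the format of the conclusion of `stub_poorRigidCore`, with `2 ≤ k + 1 ≤ 2 (r + 1)` rungs: pigeonhole
on the `B`-free ones among the `3·2^r·|U|` reduced words of length `r + 1` based in `U`, `closed_of_collision`, and the
rung walk `t ↦ (y · z.take t, θ (y · z.take t))`, whose rungs are `θ`-orbits (pairwise equal or disjoint) and whose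
steps are parallel.  (Islands: e.g. two isomorphic components of total size `≫ n^{3/4} log n`.) [this line] -/
theorem involutive_core (n r : ℕ) (μ : Fin 3 → Equiv.Perm (Fin n)) (hμ : ∀ c, μ c * μ c = 1)
    (U : Finset (Fin n)) (hU : ∀ c, ∀ x ∈ U, μ c x ∈ U) (θ : Fin n → Fin n) (R B : Finset (Fin n))
    (hB : ∀ x ∈ U, x ∉ B → θ (θ x) = x ∧ θ x ≠ x ∧ (∀ c, θ (μ c x) = μ c (θ x)) ∧ x ∉ R ∧ θ x ∉ R)
    (hcount : U.card * U.card + 3 * 2 ^ r * ((r + 2) * B.card) < 3 * 2 ^ r * U.card) :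
    ∃ (k : ℕ) (p q : Fin (k + 1) → Fin n) (col : Fin (k + 1) → Fin 3),
      (∀ i, p i ≠ q i) ∧
      (∀ i, (μ (col i) (p i) = p (i + 1) ∧ μ (col i) (q i) = q (i + 1)) ∨
        (μ (col i) (p i) = q (i + 1) ∧ μ (col i) (q i) = p (i + 1))) ∧
      (∀ i, col i ≠ col (i + 1)) ∧
      (∀ i j, (p i = p j ∧ q i = q j) ∨ (p i = q j ∧ q i = p j) ∨
        (p i ≠ p j ∧ p i ≠ q j ∧ q i ≠ p j ∧ q i ≠ q j)) ∧
      (∀ i, p i ∉ R ∧ q i ∉ R) ∧ 2 ≤ k + 1 ∧ k + 1 ≤ 2 * (r + 1) := by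
  classical
  obtain ⟨F, hF, hF'⟩ := TwinSupply.exists_reducedWords r
  -- based walks `(x, cb)`; the BAD ones meet `B` at some time `j ≤ r + 1`
  let Bad : Finset (Fin n × (Fin 3 × (Fin r → Fin 2))) :=
    ((range (r + 2)) ×ˢ (univ : Finset (Fin 3 × (Fin r → Fin 2)))).biUnion fun jc =>
      (univ.filter fun x : Fin n => ((F jc.2).take jc.1).foldl (fun v c => μ c v) x ∈ B).image
        fun x => (x, jc.2)
  have memBad : ∀ (a : Fin n × (Fin 3 × (Fin r → Fin 2))) (j : ℕ), j < r + 2 →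
      ((F a.2).take j).foldl (fun v c => μ c v) a.1 ∈ B → a ∈ Bad := fun a j hj hm =>
    mem_biUnion.2 ⟨(j, a.2), mem_product.2 ⟨mem_range.2 hj, mem_univ _⟩,
      mem_image.2 ⟨a.1, mem_filter.2 ⟨mem_univ _, hm⟩, rfl⟩⟩
  have hBad : Bad.card ≤ 3 * 2 ^ r * ((r + 2) * B.card) := by
    calc Bad.card ≤ ((range (r + 2)) ×ˢ (univ : Finset (Fin 3 × (Fin r → Fin 2)))).card * B.card :=
          card_biUnion_le_card_mul _ _ _ fun jc _ =>
            card_image_le.trans (card_le_card_of_injOn (fun x => ((F jc.2).take jc.1).foldl (fun v c => μ c v) x)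
              (fun x hx => (mem_filter.1 (mem_coe.1 hx)).2) (foldl_injective μ _).injOn)
      _ = 3 * 2 ^ r * ((r + 2) * B.card) := by
          rw [card_product, card_range, card_univ, Fintype.card_prod, Fintype.card_fin, Fintype.card_fun,
            Fintype.card_fin, Fintype.card_fin]
          ring
  -- the GOOD walks based in `U` avoid `B` at all times; there are `> |U|²` of them
  let Good : Finset (Fin n × (Fin 3 × (Fin r → Fin 2))) := (U ×ˢ univ) \ Bad
  have hGood : ∀ a ∈ Good, ∀ i : ℕ, ((F a.2).take i).foldl (fun v c => μ c v) a.1 ∉ B := by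
    intro a ha i hm
    refine (mem_sdiff.1 ha).2 ?_
    rcases Nat.lt_or_ge (r + 1) i with hi | hi
    · refine memBad a (r + 1) (by omega) ?_
      have hl : (F a.2).length ≤ i := by rw [(hF' a.2).2]; omega
      rwa [List.take_of_length_le hl, ← List.take_of_length_le (le_of_eq (hF' a.2).2)] at hm
    · exact memBad a i (by omega) hm
  have hGood_card : U.card * U.card < Good.card := by
    have hΩ : (U ×ˢ (univ : Finset (Fin 3 × (Fin r → Fin 2)))).card = 3 * 2 ^ r * U.card := by
      rw [card_product, card_univ, Fintype.card_prod, Fintype.card_fin, Fintype.card_fun, Fintype.card_fin,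
        Fintype.card_fin]
      ring
    have hG : (U ×ˢ (univ : Finset (Fin 3 × (Fin r → Fin 2)))).card ≤ Good.card + Bad.card :=
      card_le_card_sdiff_add_card
    rw [hΩ] at hG
    set X := 3 * 2 ^ r * U.card
    set Y := 3 * 2 ^ r * ((r + 2) * B.card)
    omega
  -- pigeonhole 1: a start vertex `x ∈ U` with `> |U|` good words; pigeonhole 2: two with the same endpoint (in `U`)
  obtain ⟨x, hxU, hx⟩ := exists_lt_card_fiber_of_mul_lt_card_of_maps_to (s := Good) (t := U) (f := Prod.fst)
    (fun a ha => (mem_product.1 (mem_sdiff.1 ha).1).1) hGood_card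
  obtain ⟨a, ha, a', ha', hne, hcoll⟩ := exists_ne_map_eq_of_card_lt_of_maps_to (t := U)
    (f := fun a : Fin n × (Fin 3 × (Fin r → Fin 2)) => (F a.2).foldl (fun v c => μ c v) x)
    hx (fun a _ => foldl_mem μ U hU _ x hxU)
  have hax : a.1 = x := (mem_filter.1 ha).2
  have hax' : a'.1 = x := (mem_filter.1 ha').2
  have hww : F a.2 ≠ F a'.2 := fun h => hne (Prod.ext (hax.trans hax'.symm) (hF h))
  have hPa : ∀ i, ((F a.2).take i).foldl (fun v c => μ c v) x ∉ B ∧ ((F a.2).take i).foldl (fun v c => μ c v) x ∈ U :=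
    fun i => ⟨hax ▸ hGood a (mem_filter.1 ha).1 i, foldl_mem μ U hU _ x hxU⟩
  have hPa' : ∀ i, ((F a'.2).take i).foldl (fun v c => μ c v) x ∉ B ∧
      ((F a'.2).take i).foldl (fun v c => μ c v) x ∈ U :=
    fun i => ⟨hax' ▸ hGood a' (mem_filter.1 ha').1 i, foldl_mem μ U hU _ x hxU⟩
  -- the closed walk, `B`-free and inside `U`
  obtain ⟨y, z, hz0, hzc, hzlen, hfix, hP⟩ := closed_of_collision μ hμ (fun v => v ∉ B ∧ v ∈ U) _ (F a.2) (F a'.2)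
    x le_rfl (by rw [(hF' a.2).2, (hF' a'.2).2]) hww (hF' a.2).1 (hF' a'.2).1 hcoll hPa hPa'
  rw [(hF' a.2).2, (hF' a'.2).2] at hzlen
  have hℓ2 : 2 ≤ z.length := by
    match z, hz0, hzc with
    | [c], _, hc => simp at hc
    | _ :: _ :: _, _, _ => simp
  obtain ⟨k, hk⟩ : ∃ k, z.length = k + 1 := ⟨z.length - 1, by omega⟩
  have hval : ∀ t : Fin (k + 1), ((t + 1 : Fin (k + 1)) : ℕ) = ((t : ℕ) + 1) % z.length := by
    intro t
    rw [Fin.val_add, hk]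
    simp
  -- the rung walk `t ↦ (y · z.take t, θ (y · z.take t))`
  set Pt : Fin (k + 1) → Fin n := fun t => (z.take (t : ℕ)).foldl (fun v c => μ c v) y with hPt
  have hθ : ∀ t : Fin (k + 1), θ (θ (Pt t)) = Pt t ∧ θ (Pt t) ≠ Pt t ∧ (∀ c, θ (μ c (Pt t)) = μ c (θ (Pt t))) ∧
      Pt t ∉ R ∧ θ (Pt t) ∉ R := fun t => hB _ (hP t).2 (hP t).1
  refine ⟨k, Pt, fun t => θ (Pt t), fun t => z[(t : ℕ)]'(by omega), ?_, ?_, ?_, ?_, ?_, by omega, by omega⟩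
  · exact fun t h => (hθ t).2.1 h.symm
  · intro t
    left
    have step : μ z[(t : ℕ)] (Pt t) = Pt (t + 1) := by
      simp only [hPt]
      rw [foldl_take_step μ z y hfix t (by omega), hval]
    exact ⟨step, by rw [← (hθ t).2.2.1, step]⟩
  · intro t
    exact cyclic_ne hzc t _ (by omega) (by rw [hval]; exact Nat.mod_lt _ (by omega)) (hval t)
  · intro i j
    dsimp only
    by_cases h1 : Pt i = Pt j
    · exact Or.inl ⟨h1, by rw [h1]⟩
    · by_cases h2 : Pt i = θ (Pt j)
      · exact Or.inr (Or.inl ⟨h2, by rw [h2, (hθ j).1]⟩)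
      · refine Or.inr (Or.inr ⟨h1, h2, fun h => h2 ?_, fun h => h1 ?_⟩)
        · rw [← h, (hθ i).1]
        · rw [← (hθ i).1, h, (hθ j).1]
  · exact fun t => ⟨(hθ t).2.2.2.1, (hθ t).2.2.2.2⟩

/-- Numerics of the scale `r = ⌊log₂ n⌋ + 1`: `(9 (m + 3))⁴ ≤ 2^m` for `m ≥ 40`. -/
theorem numeric_key : ∀ m, 40 ≤ m → (9 * (m + 3)) ^ 4 ≤ 2 ^ m := by
  intro m hm
  induction m, hm using Nat.le_induction with
  | base => norm_num
  | succ m hm ih =>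
    have e1 : (m + 3) ^ 2 ≤ (m + 3) ^ 3 := Nat.pow_le_pow_right (by omega) (by norm_num)
    have e2 : (m + 3) ≤ (m + 3) ^ 2 := by nlinarith
    have e3 : 43 * (m + 3) ^ 3 ≤ (m + 3) ^ 4 := by
      calc 43 * (m + 3) ^ 3 ≤ (m + 3) * (m + 3) ^ 3 := Nat.mul_le_mul_right _ (by omega)
        _ = (m + 3) ^ 4 := by ring
    have h1 : (m + 4) ^ 4 ≤ 2 * (m + 3) ^ 4 := by
      rw [(by ring : (m + 4) ^ 4 = (m + 3) ^ 4 + (4 * (m + 3) ^ 3 + 6 * (m + 3) ^ 2 + 4 * (m + 3) + 1))]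
      linarith
    calc (9 * (m + 1 + 3)) ^ 4 = 9 ^ 4 * (m + 4) ^ 4 := by ring
      _ ≤ 9 ^ 4 * (2 * (m + 3) ^ 4) := Nat.mul_le_mul_left _ h1
      _ = 2 * (9 * (m + 3)) ^ 4 := by ring
      _ ≤ 2 * 2 ^ m := Nat.mul_le_mul_left _ ih
      _ = 2 ^ (m + 1) := by ring

/-- **The involutive-symmetry regime of `stub_poorRigidCore`** (registered `--supports` form `stub_involutiveSymmetry`;
the core's conclusion verbatim, its host and forbidden-set hypotheses verbatim, poorness and rigidity NOT needed):
for `n ≥ 2^40`, three fixed-point-free involutions `μ i`, a forbidden set `|R| ≤ n^{3/4}`, and a map `θ` which off an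
exceptional set `|E| ≤ n^{3/4}` is a fixed-point-free involution commuting with the three colours, there is a clean
closed colour-walk of the rung graph avoiding `R` with `k + 1 ≤ n^{1/4}` rungs.  Proof: `involutive_core` at
`r = ⌊log₂ n⌋ + 1` with `B := R ∪ E ∪ θ⁻¹(R)` (`|B| ≤ 3 n^{3/4}`, `3 (r + 2) |B| ≤ 9 (r + 2) n^{3/4} ≤ n` and
`k + 1 ≤ 2 r + 2 ≤ n^{1/4}`, both by `numeric_key`). [this line] -/
theorem stub_involutiveSymmetry : ∃ n₀ : ℕ, ∀ n ≥ n₀, ∀ μ : Fin 3 → Equiv.Perm (Fin n), (∀ i, μ i * μ i = 1 ∧ ∀ v, μ i v ≠ v) → ∀ R : Finset (Fin n), (R.card : ℝ) ≤ (n : ℝ) ^ ((3 : ℝ) / 4) → ∀ (θ : Fin n → Fin n) (E : Finset (Fin n)), (E.card : ℝ) ≤ (n : ℝ) ^ ((3 : ℝ) / 4) → (∀ x, x ∉ E → θ (θ x) = x ∧ θ x ≠ x ∧ ∀ c, θ (μ c x) = μ c (θ x)) → ∃ (k : ℕ) (p q : Fin (k + 1) → Fin n) (col : Fin (k + 1)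 → Fin 3), (∀ i, p i ≠ q i) ∧ (∀ i, (μ (col i) (p i) = p (i + 1) ∧ μ (col i) (q i) = q (i + 1)) ∨ (μ (col i) (p i) = q (i + 1) ∧ μ (col i) (q i) = p (i + 1))) ∧ (∀ i, col i ≠ col (i + 1)) ∧ (∀ i j, (p i = p j ∧ q i = q j) ∨ (p i = q j ∧ q i = p j) ∨ (p i ≠ p j ∧ p i ≠ q j ∧ q i ≠ p j ∧ q i ≠ q j)) ∧ (∀ i, p i ∉ R ∧ q i ∉ R) ∧ ((k : ℝ) + 1) ≤ (n : ℝ) ^ ((1 : ℝ) / 4) := by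
  refine ⟨2 ^ 40, fun n hn μ hμ R hR θ E hE hθ => ?_⟩
  classical
  -- the scale `m = ⌊log₂ n⌋`
  set m := Nat.log 2 n with hm
  have hn0 : n ≠ 0 := by rintro rfl; exact absurd hn (by norm_num)
  have h2m : 2 ^ m ≤ n := Nat.pow_log_le_self 2 hn0
  have hn2 : n < 2 ^ (m + 1) := Nat.lt_pow_succ_log_self one_lt_two n
  have key : (9 * (m + 3)) ^ 4 ≤ n := (numeric_key m (Nat.le_log_of_pow_le one_lt_two hn)).trans h2m
  -- the bad set `B := R ∪ E ∪ θ⁻¹(R)`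
  let B : Finset (Fin n) := R ∪ E ∪ (univ.filter fun x => x ∉ E ∧ θ x ∈ R)
  have hBR : ∀ x, x ∉ B → θ (θ x) = x ∧ θ x ≠ x ∧ (∀ c, θ (μ c x) = μ c (θ x)) ∧ x ∉ R ∧ θ x ∉ R := by
    intro x hx
    simp only [B, mem_union, mem_filter, mem_univ, true_and, not_or, not_and] at hx
    obtain ⟨⟨hxR, hxE⟩, hxT⟩ := hx
    exact ⟨(hθ x hxE).1, (hθ x hxE).2.1, (hθ x hxE).2.2, hxR, hxT hxE⟩
  have hBcard : B.card ≤ R.card + E.card + R.card := by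
    refine (card_union_le _ _).trans (add_le_add (card_union_le _ _) ?_)
    refine card_le_card_of_injOn θ (fun x hx => (mem_filter.1 (mem_coe.1 hx)).2.2) ?_
    intro x hx x' hx' h
    rw [← (hθ x (mem_filter.1 (mem_coe.1 hx)).2.1).1, h, (hθ x' (mem_filter.1 (mem_coe.1 hx')).2.1).1]
  -- `9 (m + 3) ≤ n^{1/4}`, hence `3 (m + 3) |B| ≤ n`
  have hnpos : (0 : ℝ) < n := by exact_mod_cast Nat.pos_of_ne_zero hn0
  have hkey : ((9 * (m + 3) : ℕ) : ℝ) ≤ (n : ℝ) ^ ((1 : ℝ) / 4) := by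
    have h1 : (((9 * (m + 3) : ℕ) : ℝ)) ^ 4 ≤ (n : ℝ) := by exact_mod_cast key
    have e : ((((9 * (m + 3) : ℕ) : ℝ)) ^ 4) ^ ((1 : ℝ) / 4) = ((9 * (m + 3) : ℕ) : ℝ) := by
      rw [one_div]
      exact Real.pow_rpow_inv_natCast (by positivity) four_ne_zero
    exact e.symm.trans_le (Real.rpow_le_rpow (by positivity) h1 (by norm_num))
  have hB3 : ((3 * (m + 3) * B.card : ℕ) : ℝ) ≤ n := by
    have hb : (B.card : ℝ) ≤ 3 * (n : ℝ) ^ ((3 : ℝ) / 4) := by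
      have : (B.card : ℝ) ≤ R.card + E.card + R.card := by exact_mod_cast hBcard
      linarith
    calc ((3 * (m + 3) * B.card : ℕ) : ℝ) = 3 * ((m : ℝ) + 3) * B.card := by push_cast; ring
      _ ≤ 3 * ((m : ℝ) + 3) * (3 * (n : ℝ) ^ ((3 : ℝ) / 4)) := by gcongr
      _ = ((9 * (m + 3) : ℕ) : ℝ) * (n : ℝ) ^ ((3 : ℝ) / 4) := by push_cast; ring
      _ ≤ (n : ℝ) ^ ((1 : ℝ) / 4) * (n : ℝ) ^ ((3 : ℝ) / 4) := by gcongr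
      _ = n := by rw [← Real.rpow_add hnpos]; norm_num
  have hB3' : 3 * (m + 3) * B.card ≤ n := by exact_mod_cast hB3
  -- the counting hypothesis of `involutive_core` at `r = m + 1`
  have hcount : n * n + 3 * 2 ^ (m + 1) * ((m + 1 + 2) * B.card) < 3 * 2 ^ (m + 1) * n := by
    have h2 : 2 ^ (m + 1) ≤ 2 * n := by rw [pow_succ]; omega
    have h3 : 3 * 2 ^ (m + 1) * ((m + 1 + 2) * B.card) ≤ 2 * n * n := by
      calc 3 * 2 ^ (m + 1) * ((m + 1 + 2) * B.card) = 2 ^ (m + 1) * (3 * (m + 3) * B.card) := by ring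
        _ ≤ (2 * n) * n := Nat.mul_le_mul h2 hB3'
        _ = 2 * n * n := by ring
    have h4 : 3 * (n + 1) * n ≤ 3 * 2 ^ (m + 1) * n := Nat.mul_le_mul_right _ (Nat.mul_le_mul_left _ hn2)
    have h5 : 0 < n := Nat.pos_of_ne_zero hn0
    nlinarith
  obtain ⟨k, p, q, col, h1, h2, h3, h4, h5, -, h7⟩ := involutive_core n (m + 1) μ (fun c => (hμ c).1) univ
    (fun c x _ => mem_univ _) θ R B (fun x _ hx => hBR x hx) (by rw [card_univ, Fintype.card_fin]; exact hcount)
  exact ⟨k, p, q, col, h1, h2, h3, h4, h5, le_trans (by exact_mod_cast (by omega : k + 1 ≤ 9 * (m + 3))) hkey⟩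

end Summit.MatrixMultiplication.MatrixMultiplication.Theorems.HyperoctahedralThreshold.InvolutiveSymmetry
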